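import Summits.QuantumFields.YangMills.Theorems.BalabanUVNodesN08HaarCompatibilityGuardJacobianSharp

/-!
# BalabanUVNodes ∕ N08 — THE STRENGTHENED PERSPECTIVE INEQUALITY (S3) BEHIND THE SHARP HILBERT–SCHMIDT JACOBIAN BOUND:
# `φ(β) − μφ(β∕μ) ≥ (1−μ)·χ(β) + ((1−μ)∕2)·(χ(β) − 1)²` on `|β| ≤ μ ≤ 1` (`φ = β cot β`, `χ = β∕sin β`) — real analysis only

WIDTH SEAT `pub-ymgap-dag-n08-w6` g3 (R399 (3a) second wave; self-located CLAIM-2 of record HOME INBOX l.30413, successor of CLAIM-1 = p609767 ✓ ∕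
p610204 ✓), 2026-08-28.  Track A, DAG node N08 = [Balaban1985UV3] Thm 1 p. 257 (compact) + Thm 2 p. 272; key item K1⁷ `StabilityBAtRecordR13SepCoPH`
(stmt-QuantumFields-20542), `--supports … --as helper`.  COUNT-NEUTRAL.  Part 3a of the `…GuardJacobianSharp*` series (split at the 400-line lint):
the scalar input of part 3b `…GuardJacobianSharpNorm` (the sharp norm bound `‖D K_W(WX)‖_HS ≥ (1 − Σcᵢ)‖X‖_HS`).

THE POINT.  Part 2's `sharp_coercive` (`Q ⪰ λ·χ(B_Y)`, `λ = 1 − Σcᵢ`) rests on the perspective inequality `φ(β) − μφ(β∕μ) ≥ (1−μ)χ(β)`, which is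
EXACTLY the concavity of `sin`.  The Hilbert–Schmidt NORM bound of part 3b needs the same inequality with an extra square on the right,
  (S3)  `φ(β) − μ·φ(β∕μ) ≥ (1−μ)·χ(β) + ((1−μ)∕2)·(χ(β) − 1)²`,   `|β| ≤ μ ≤ 1`,
equivalently (`t = β∕μ`, `λ = 1 − μ`, so `β = (1−λ)t` and `λt = t − β`)
  `β·(sin(λt) − λ·sin t)·sin β ≥ (λ∕2)·(β − sin β)²·sin t`  (`persp_core`).
It has genuine slack (ratio `(LHS − RHS)∕(λβ²) ≥ 1∕6` numerically) and an elementary proof: the concavity defect of `sin` is at least cubic,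
`sin(λt) − λ sin t ≥ (2λ(1−λ²)∕(3π²))·t³` on `[0,1]` (`sin_mul_sub_mul_sin_ge`: the derivative of the defect is `2λ sin((1+λ)t∕2) sin((1−λ)t∕2)`,
bounded below through Jordan's `sin x ≥ (2∕π)x`, Mathlib's `Real.mul_le_sin`, then `monotoneOn_of_deriv_nonneg`), while `β − β³∕6 ≤ sin β ≤ β`
(`Real.sin_gt_sub_cube`, `Real.sin_le`) and `sin t ≤ t` bound the other factors; the comparison closes on `π² < 16`.

WHAT THIS FILE PROVES ([folklore] real analysis over Mathlib; nothing of Bałaban's asserted; 0 `def`).  `sin_mul_sub_mul_sin_ge` · `persp_core` ·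
`persp_scalar_strong_pos` · ★ `persp_scalar_strong` ((S3) in the `ψ`∕`sinc` currency of parts 1–2:
`(1−μ)(sinc β)⁻¹ + ((1−μ)∕2)((sinc β)⁻¹ − 1)² ≤ (1 − ψ β) − μ(1 − ψ(β∕μ))`, `|β| ≤ μ ≤ 1`).

HONEST FRAMING.  Count-neutral helper; trigonometry only; E6′ NOT decided; `hmass` NOT supplied; N08 NOT discharged; counts unmoved (typed 28∕28 ·
discharged 5∕27); no summit statement is proved by this seat — one finite 𝕋⁴ programme at fixed ε, R4 closes the CONDITIONAL rung `BalabanLadder.UV` only;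
the Yang–Mills mass gap (Clay) is NOT proved by any of this; nothing continuum ∕ ℝ⁴ ∕ OS ∕ mass gap.  0 `sorry`, 0 `def`, 0 `instance`, 0 `notation`,
standard axioms.
-/

noncomputable section

open NormedSpace Finset
open scoped Matrix Matrix.Norms.L2Operator ComplexConjugate Nat

namespace Summit.QuantumFields.YangMills.BalabanUVNodes.N08HaarCompatibilityGuardJacobianSharpNormScalar

open Literature.MathematicalPhysics.QuantumFieldTheory.Balaban1983to89
open Literature.MathematicalPhysics.QuantumFieldTheory.Balaban1983to89.T4EMLTangentInjective
open Summit.QuantumFields.YangMills.BalabanUVNodes.N08HaarCompatibilityGuardJacobian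
open Summit.QuantumFields.YangMills.BalabanUVNodes.N08HaarCompatibilityGuardJacobianSharpFrame
open Summit.QuantumFields.YangMills.BalabanUVNodes.N08HaarCompatibilityGuardJacobianSharp
open Matrix (single diagonal unitaryGroup)
open Complex (I)
open Literature.MathematicalPhysics.QuantumFieldTheory.Balaban1983to89.MatrixLog (mlog)
open T4QuatExpLog (ψ ψ_zero ψ_of_ne_zero)

variable {m : Type*} [Fintype m]

/-! ## §1 The concavity defect of `sin` is at least cubic; (S3) -/

omit [Fintype m] in
/-- **A cubic lower bound for the concavity defect of `sin`**: `(2l(1−l²)∕(3π²))·t³ ≤ sin(l t) − l·sin t` for `0 ≤ l ≤ 1`,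
`0 ≤ t ≤ 1` — the derivative of the right side is `2l·sin((1+l)t∕2)·sin((1−l)t∕2) ≥ (2l(1−l²)∕π²)·t²` by Jordan's inequality
`sin x ≥ (2∕π)x` on `[0, π∕2]`. [folklore] -/
theorem sin_mul_sub_mul_sin_ge {l t : ℝ} (hl0 : 0 ≤ l) (hl1 : l ≤ 1) (ht0 : 0 ≤ t) (ht1 : t ≤ 1) :
    2 * l * (1 - l ^ 2) / (3 * Real.pi ^ 2) * t ^ 3 ≤ Real.sin (l * t) - l * Real.sin t := by
  set c : ℝ := 2 * l * (1 - l ^ 2) / (3 * Real.pi ^ 2) with hc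
  have hπ3 : (3 : ℝ) < Real.pi := Real.pi_gt_three
  have hπ0 : 0 < Real.pi := Real.pi_pos
  have hc0 : 0 ≤ c := by
    rw [hc]; apply div_nonneg _ (by positivity); have : l ^ 2 ≤ 1 := by nlinarith
    nlinarith
  let F : ℝ → ℝ := fun x => Real.sin (l * x) - l * Real.sin x - c * x ^ 3
  have hderiv : ∀ x, HasDerivAt F (l * Real.cos (l * x) - l * Real.cos x - c * (3 * x ^ 2)) x := by
    intro x
    have h1 : HasDerivAt (fun x => Real.sin (l * x)) (Real.cos (l * x) * (l * 1)) x :=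
      (Real.hasDerivAt_sin (l * x)).comp x ((hasDerivAt_id x).const_mul l)
    have h2 : HasDerivAt (fun x => l * Real.sin x) (l * Real.cos x) x := (Real.hasDerivAt_sin x).const_mul l
    have h3 : HasDerivAt (fun x => c * x ^ 3) (c * (3 * x ^ 2)) x := by
      simpa using (hasDerivAt_pow 3 x).const_mul c
    exact ((h1.sub h2).sub h3).congr_deriv (by ring)
  have hcont : ContinuousOn F (Set.Icc 0 1) := fun x _ => (hderiv x).continuousAt.continuousWithinAt
  have hdiff : DifferentiableOn ℝ F (interior (Set.Icc 0 1)) := fun x _ => (hderiv x).differentiableAt.differentiableWithinAt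
  have hpos : ∀ x ∈ interior (Set.Icc (0 : ℝ) 1), 0 ≤ deriv F x := by
    intro x hx
    rw [interior_Icc] at hx
    obtain ⟨hx0, hx1⟩ := hx
    rw [(hderiv x).deriv]
    have hcos : Real.cos (l * x) - Real.cos x = 2 * Real.sin ((1 + l) * x / 2) * Real.sin ((1 - l) * x / 2) := by
      rw [Real.cos_sub_cos, show (l * x - x) / 2 = -((1 - l) * x / 2) by ring, Real.sin_neg,
        show (l * x + x) / 2 = (1 + l) * x / 2 by ring]
      ring
    have ha0 : 0 ≤ (1 + l) * x / 2 := by positivity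
    have ha1 : (1 + l) * x / 2 ≤ Real.pi / 2 := by nlinarith
    have h1l : 0 ≤ 1 - l := by linarith
    have hb0 : 0 ≤ (1 - l) * x / 2 := by positivity
    have hb1 : (1 - l) * x / 2 ≤ Real.pi / 2 := by nlinarith
    have hj1 := Real.mul_le_sin ha0 ha1
    have hj2 := Real.mul_le_sin hb0 hb1
    have hj1' : 0 ≤ 2 / Real.pi * ((1 + l) * x / 2) := by positivity
    have hj2' : 0 ≤ 2 / Real.pi * ((1 - l) * x / 2) := mul_nonneg (by positivity) hb0
    have hprod : (2 / Real.pi * ((1 + l) * x / 2)) * (2 / Real.pi * ((1 - l) * x / 2))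
        ≤ Real.sin ((1 + l) * x / 2) * Real.sin ((1 - l) * x / 2) :=
      mul_le_mul hj1 hj2 hj2' (hj1'.trans hj1)
    have hkey : c * (3 * x ^ 2) = l * (2 * ((2 / Real.pi * ((1 + l) * x / 2)) * (2 / Real.pi * ((1 - l) * x / 2)))) := by
      rw [hc]; field_simp; ring
    calc (0 : ℝ) ≤ l * (2 * (Real.sin ((1 + l) * x / 2) * Real.sin ((1 - l) * x / 2)
          - (2 / Real.pi * ((1 + l) * x / 2)) * (2 / Real.pi * ((1 - l) * x / 2)))) := by
            apply mul_nonneg hl0; linarith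
      _ = l * Real.cos (l * x) - l * Real.cos x - c * (3 * x ^ 2) := by
            rw [hkey, ← mul_sub, hcos]; ring
  have hmono := monotoneOn_of_deriv_nonneg (convex_Icc 0 1) hcont hdiff hpos
  have h := hmono (Set.left_mem_Icc.2 zero_le_one) ⟨ht0, ht1⟩ ht0
  simp only [F, mul_zero, Real.sin_zero, sub_zero] at h
  have : (0 : ℝ) ^ 3 = 0 := by norm_num
  rw [this, mul_zero, sub_zero] at h
  linarith

omit [Fintype m] in
/-- The cleared-denominator core of (S3), `0 < μ ≤ 1`, `0 < t ≤ 1`, `β = μt`, `λ = 1 − μ`: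
`(λ∕2)·(β − sin β)²·sin t ≤ β·(sin(λt) − λ·sin t)·sin β` — from the cubic bound, `β − β³∕6 ≤ sin β ≤ β`, `sin t ≤ t`
and `π² < 16`. [folklore] -/
theorem persp_core {μ t : ℝ} (hμ0 : 0 < μ) (hμ1 : μ ≤ 1) (ht0 : 0 < t) (ht1 : t ≤ 1) :
    (1 - μ) / 2 * (μ * t - Real.sin (μ * t)) ^ 2 * Real.sin t
      ≤ μ * t * (Real.sin ((1 - μ) * t) - (1 - μ) * Real.sin t) * Real.sin (μ * t) := by
  set β : ℝ := μ * t with hβ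
  set l : ℝ := 1 - μ with hl
  have hπ3 : (3 : ℝ) < Real.pi := Real.pi_gt_three
  have hπ4 : Real.pi < 4 := Real.pi_lt_four
  have hβ0 : 0 < β := mul_pos hμ0 ht0
  have hβ1 : β ≤ 1 := by rw [hβ]; nlinarith
  have hl0 : 0 ≤ l := by rw [hl]; linarith
  have hl1 : l ≤ 1 := by rw [hl]; linarith
  have hA := sin_mul_sub_mul_sin_ge hl0 hl1 ht0.le ht1
  have hB : β - β ^ 3 / 6 ≤ Real.sin β := (Real.sin_gt_sub_cube hβ0).le
  have hB' : Real.sin β ≤ β := Real.sin_le hβ0.le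
  have hT : Real.sin t ≤ t := Real.sin_le ht0.le
  have hT0 : 0 < Real.sin t := Real.sin_pos_of_pos_of_lt_pi ht0 (by linarith)
  have hS0 : 0 < Real.sin β := Real.sin_pos_of_pos_of_lt_pi hβ0 (by linarith)
  -- right side ≥ c t³ · β · (β − β³/6)
  have hc0 : 0 ≤ 2 * l * (1 - l ^ 2) / (3 * Real.pi ^ 2) * t ^ 3 := by
    apply mul_nonneg (div_nonneg _ (by positivity)) (by positivity)
    have : l ^ 2 ≤ 1 := by nlinarith
    nlinarith
  have hβ3 : β ^ 3 ≤ β := by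
    have : β ^ 2 ≤ 1 := by nlinarith
    nlinarith
  have hR : β * (2 * l * (1 - l ^ 2) / (3 * Real.pi ^ 2) * t ^ 3) * (β - β ^ 3 / 6)
      ≤ β * (Real.sin (l * t) - l * Real.sin t) * Real.sin β := by
    apply mul_le_mul (mul_le_mul_of_nonneg_left hA hβ0.le) hB (by linarith) (mul_nonneg hβ0.le (hc0.trans hA))
  -- left side ≤ (l/2)·(β³/6)²·t
  have hL : l / 2 * (β - Real.sin β) ^ 2 * Real.sin t ≤ l / 2 * (β ^ 3 / 6) ^ 2 * t := by
    have h1 : (β - Real.sin β) ^ 2 ≤ (β ^ 3 / 6) ^ 2 := pow_le_pow_left₀ (by linarith) (by linarith) 2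
    apply mul_le_mul (mul_le_mul_of_nonneg_left h1 (by linarith)) hT hT0.le (by positivity)
  -- the polynomial comparison
  have hπsq : Real.pi ^ 2 < 16 := by nlinarith
  have hM : l / 2 * (β ^ 3 / 6) ^ 2 * t ≤ β * (2 * l * (1 - l ^ 2) / (3 * Real.pi ^ 2) * t ^ 3) * (β - β ^ 3 / 6) := by
    rw [hβ, hl]
    have hμt : μ * t ≤ 1 := by nlinarith
    have h2 : 0 ≤ 1 - μ := by linarith
    have hπinv : 1 / 16 ≤ 1 / Real.pi ^ 2 := one_div_le_one_div_of_le (by positivity) hπsq.le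
    have h4 : 5 / 6 ≤ 1 - (μ * t) ^ 2 / 6 := by nlinarith
    have h5 : 1 ≤ 2 - μ := by linarith
    have hkey : μ ^ 3 * t ^ 2 / 72 ≤ 2 * (2 - μ) / (3 * Real.pi ^ 2) * (1 - (μ * t) ^ 2 / 6) := by
      have hq : 2 * (2 - μ) / (3 * Real.pi ^ 2) * (1 - (μ * t) ^ 2 / 6)
          = (2 - μ) * (1 - (μ * t) ^ 2 / 6) * (2 / 3) * (1 / Real.pi ^ 2) := by
        field_simp
      have hμ3 : μ ^ 3 ≤ 1 := by nlinarith
      calc μ ^ 3 * t ^ 2 / 72 ≤ 1 / 72 := by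
            rw [div_le_div_iff_of_pos_right (by norm_num : (0:ℝ) < 72)]; nlinarith
        _ ≤ 1 * (5 / 6) * (2 / 3) * (1 / 16) := by norm_num
        _ ≤ (2 - μ) * (1 - (μ * t) ^ 2 / 6) * (2 / 3) * (1 / Real.pi ^ 2) := by gcongr
        _ = _ := hq.symm
    have e1 : (1 - μ) / 2 * ((μ * t) ^ 3 / 6) ^ 2 * t = ((1 - μ) * (μ ^ 3 * t ^ 5)) * (μ ^ 3 * t ^ 2 / 72) := by ring
    have e2 : μ * t * (2 * (1 - μ) * (1 - (1 - μ) ^ 2) / (3 * Real.pi ^ 2) * t ^ 3) * (μ * t - (μ * t) ^ 3 / 6)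
        = ((1 - μ) * (μ ^ 3 * t ^ 5)) * (2 * (2 - μ) / (3 * Real.pi ^ 2) * (1 - (μ * t) ^ 2 / 6)) := by
      field_simp
      ring
    rw [e1, e2]
    exact mul_le_mul_of_nonneg_left hkey (mul_nonneg h2 (by positivity))
  exact hL.trans (hM.trans hR)

omit [Fintype m] in
/-- (S3) for `0 < β ≤ μ ≤ 1`. [folklore] -/
theorem persp_scalar_strong_pos {μ β : ℝ} (hβ : 0 < β) (hβμ : β ≤ μ) (hμ1 : μ ≤ 1) :
    (1 - μ) * (Real.sinc β)⁻¹ + (1 - μ) / 2 * ((Real.sinc β)⁻¹ - 1) ^ 2 ≤ (1 - ψ β) - μ * (1 - ψ (β / μ)) := by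
  have hμ : 0 < μ := hβ.trans_le hβμ
  have hπ3 : (3 : ℝ) < Real.pi := Real.pi_gt_three
  set t : ℝ := β / μ with ht
  have ht0 : 0 < t := div_pos hβ hμ
  have ht1 : t ≤ 1 := (div_le_one hμ).2 hβμ
  have hβ1 : β ≤ 1 := hβμ.trans hμ1
  have hsβ : 0 < Real.sin β := Real.sin_pos_of_pos_of_lt_pi hβ (by linarith)
  have hst : 0 < Real.sin t := Real.sin_pos_of_pos_of_lt_pi ht0 (by linarith)
  have hμt : μ * t = β := by rw [ht]; field_simp
  rw [Real.sinc_of_ne_zero hβ.ne', inv_div, ψ_of_ne_zero hβ.ne', ψ_of_ne_zero ht0.ne', sub_sub_cancel, sub_sub_cancel]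
  have key : Real.sin ((1 - μ) * t) = Real.sin t * Real.cos β - Real.cos t * Real.sin β := by
    rw [show (1 - μ) * t = t - β by rw [← hμt]; ring, Real.sin_sub]
  have hcore := persp_core hμ hμ1 ht0 ht1
  rw [hμt] at hcore
  have hdiff : β * Real.cos β / Real.sin β - μ * (t * Real.cos t / Real.sin t)
      - ((1 - μ) * (β / Real.sin β) + (1 - μ) / 2 * (β / Real.sin β - 1) ^ 2)
      = (β * (Real.sin ((1 - μ) * t) - (1 - μ) * Real.sin t) * Real.sin β
          - (1 - μ) / 2 * (β - Real.sin β) ^ 2 * Real.sin t) / (Real.sin β ^ 2 * Real.sin t) := by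
    rw [key, show μ * (t * Real.cos t / Real.sin t) = β * Real.cos t / Real.sin t by
      rw [← hμt]; field_simp]
    field_simp
    ring
  have hnn : 0 ≤ (β * (Real.sin ((1 - μ) * t) - (1 - μ) * Real.sin t) * Real.sin β
          - (1 - μ) / 2 * (β - Real.sin β) ^ 2 * Real.sin t) / (Real.sin β ^ 2 * Real.sin t) :=
    div_nonneg (by linarith) (by positivity)
  linarith

omit [Fintype m] in
/-- **(S3) THE STRENGTHENED PERSPECTIVE INEQUALITY**, `|β| ≤ μ ≤ 1`:
`(1−μ)·(sinc β)⁻¹ + ((1−μ)∕2)·((sinc β)⁻¹ − 1)² ≤ (1 − ψ β) − μ·(1 − ψ(β∕μ))` — part 1's `persp_scalar` with the extra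
square `(χ − 1)²` that the Hilbert–Schmidt norm bound consumes. [folklore] -/
theorem persp_scalar_strong {μ β : ℝ} (hβμ : |β| ≤ μ) (hμ1 : μ ≤ 1) :
    (1 - μ) * (Real.sinc β)⁻¹ + (1 - μ) / 2 * ((Real.sinc β)⁻¹ - 1) ^ 2 ≤ (1 - ψ β) - μ * (1 - ψ (β / μ)) := by
  rcases lt_trichotomy β 0 with hβ | hβ | hβ
  · have h := persp_scalar_strong_pos (neg_pos.2 hβ) (by rwa [abs_of_neg hβ] at hβμ) hμ1
    rwa [Real.sinc_neg, ψ_neg, neg_div, ψ_neg] at h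
  · subst hβ
    simp [Real.sinc_zero, ψ_zero]
  · exact persp_scalar_strong_pos hβ (by rwa [abs_of_pos hβ] at hβμ) hμ1

end Summit.QuantumFields.YangMills.BalabanUVNodes.N08HaarCompatibilityGuardJacobianSharpNormScalar

end
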